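import Summits.QuantumFields.YangMills.Theorems.BalabanStepParabolic.Negative.NoContinuityJunk

/-!
# `BalabanStepParabolic` — support XI: the thin-chart reduction (all structure bookkeeping discharged)

Support file for crux `stmt-QuantumFields-9684` (`ParabolicTrajectory.BalabanStepParabolic`), from the standing
disprover's work file `Cruxes/BalabanStepParabolic/Disproof.lean` (cycle 2; structural finding F3 of
`Cruxes/BalabanStepParabolic/Ideas/structuralfindings.md`, mechanised as a THEOREM rather than as a proof idea).

`nonempty_of_thinChartFunctional`: to inhabit `BalabanBanachStep G r M` (`M ≥ 2`) it SUFFICES to give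
* a parabolic coefficient `b > 0` and an inverse-coupling constant `κ > 0` (the junk flow `g ↦ g + b g³` and
  `betaOf g = κ/g²`; by `RescaleCoupling.lean` only `b κ / log M` matters),
* unit-scale normalisations `c g s` with `c g r.curvature = 1`,
* a realisation functional `X : ℝ × (ℝ × ℝ) → ℕ → (n : ℕ) → (Fin n → YMSpecies G) → (Fin n → 𝓢) → ℝ` on the THIN
  junk chart `ℝ × ℝ²` (no Banach space of actions, no linearisation, no contraction estimate, no Lipschitz bound)
  satisfying, VERBATIM, the three realisation axioms for the junk step `thinStep b (g, y) = (g + b g³, y/2)` and the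
  junk Wilson embedding `g ↦ (g, (1, g))`: (4a) `X (thinStep b p) S = X p (M S) ∘ blockDilate`, (4b)
  `X (g, (1, g)) (2L+1) = wilsonCentredSchwinger r.ρ (κ/g²) L (c g)` for `g ∈ (0, 1]`, (4c) continuity of
  `X · S n σ f` on `[0, 1] × B̄₂` for off-diagonal tuples.
(4a) comes for free from ANY germ by `orbitRec` (`OrbitRecursion.lean`, `NoContinuityJunk.lean`), and (4b)+(4a)
are jointly consistent (`preStep_nonempty`); so the whole difficulty of the crux is (4c) for such an `X`: by
`OrbitTransport.lean` this is the convergence of genuine block-dilated Wilson plaquette data at the accumulation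
points of the junk Wilson orbits INSIDE the chart. No claim is made that this is easier than the crux — it is the
crux with its bookkeeping removed (the even-`M` and trivial-group inhabitants are instances).
-/

namespace Summit.QuantumFields.YangMills.Theorems.BalabanStepParabolic.Negative

open scoped SchwartzMap
open MeasureTheory Filter Topology
open Literature.MathematicalPhysics.QuantumFieldTheory Literature.MathematicalPhysics.AQFT
open Literature.MathematicalPhysics.QuantumLattice

noncomputable section

variable {G : Type} [Group G] [TopologicalSpace G] [IsTopologicalGroup G] [CompactSpace G]
  [MeasurableSpace G] [BorelSpace G] (r : LatticeRep G) (M : ℕ)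

/-- The thin junk step with parabolic coefficient `b`: `(g, y) ↦ (g + b g³, y/2)`. -/
def thinStep (b : ℝ) (p : ℝ × (ℝ × ℝ)) : ℝ × (ℝ × ℝ) := (p.1 + b * p.1 ^ 3, (1 / 2 : ℝ) • p.2)

/-- **The thin-chart reduction.** See the module docstring: a realisation functional on the junk chart
`ℝ × ℝ²` satisfying the three realisation axioms for the junk step and junk Wilson embedding inhabits the full
structure `BalabanBanachStep G r M`. [folklore] -/
theorem nonempty_of_thinChartFunctional (hM : 2 ≤ M) {b κ : ℝ} (hb : 0 < b) (hκ : 0 < κ)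
    (c : ℝ → YMSpecies G → ℝ) (hc : ∀ g, c g r.curvature = 1)
    (X : ℝ × (ℝ × ℝ) → ℕ → (n : ℕ) → (Fin n → YMSpecies G) →
      (Fin n → 𝓢(EuclideanSpace ℝ (Fin 4), ℝ)) → ℝ)
    (h4a : ∀ (p : ℝ × (ℝ × ℝ)) (S n : ℕ) (σ : Fin n → YMSpecies G)
      (f : Fin n → 𝓢(EuclideanSpace ℝ (Fin 4), ℝ)),
      p.1 ∈ Set.Icc (0 : ℝ) 1 → ‖p.2‖ ≤ 2 →
        X (thinStep b p) S n σ f = X p (M * S) n σ (fun i => blockDilate M (f i)))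
    (h4b : ∀ g ∈ Set.Ioc (0 : ℝ) 1, ∀ (L n : ℕ) (σ : Fin n → YMSpecies G)
      (f : Fin n → 𝓢(EuclideanSpace ℝ (Fin 4), ℝ)),
        X (g, ((1 : ℝ), g)) (2 * L + 1) n σ f = wilsonCentredSchwinger r.ρ (κ / g ^ 2) L (c g) n σ f)
    (h4c : ∀ (S n : ℕ) (σ : Fin n → YMSpecies G) (f : Fin n → 𝓢(EuclideanSpace ℝ (Fin 4), ℝ)),
      IsOffDiagonal (SchwartzMap.tensorFin n fun i => ofRealTest (f i)) →
        ContinuousOn (fun p : ℝ × (ℝ × ℝ) => X p S n σ f)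
          (Set.Icc 0 1 ×ˢ Metric.closedBall (0 : ℝ × ℝ) 2)) :
    Nonempty (BalabanBanachStep G r M) := by
  have hlog : 0 < Real.log M := Real.log_pos (by exact_mod_cast hM)
  refine ⟨{
    E := ℝ × ℝ
    φ := fun g _ => g + b * g ^ 3
    Ψ := fun _ y => (1 / 2 : ℝ) • y
    A := (1 / 2 : ℝ) • ContinuousLinearMap.id ℝ (ℝ × ℝ)
    b := b
    θ := 1 / 2
    C := 1
    δ := 1
    b_pos := hb
    θ_nonneg := by norm_num
    θ_lt_one := by norm_num
    C_pos := one_pos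
    δ_pos := one_pos
    norm_A_le := norm_half_id_le
    remainder := fun g y _ _ => by
      constructor
      · simp only [sub_self, abs_zero]; positivity
      · rw [half_id_apply, sub_self, norm_zero]; positivity
    lipschitz_fibre := fun g y y' _ _ _ => by
      constructor
      · simp only [sub_self, abs_zero]; positivity
      · have : (1 / 2 : ℝ) • y - (1 / 2 : ℝ) • y' -
            ((1 / 2 : ℝ) • ContinuousLinearMap.id ℝ (ℝ × ℝ)) (y - y') = 0 := by
          rw [half_id_apply, smul_sub]
          abel
        rw [this, norm_zero]; positivity
    lipschitz_base := fun g g' y _ _ _ => by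
      constructor
      · have : g + b * g ^ 3 - (g' + b * g' ^ 3) - (g - g') - b * (g ^ 3 - g' ^ 3) = 0 := by ring
        rw [this, abs_zero]; positivity
      · simp only [sub_self, norm_zero]; positivity
    b₀ := b / Real.log M
    b_eq := by field_simp
    R := 2
    δ_le_R := by norm_num
    θ' := 1 / 2
    θ'_nonneg := by norm_num
    θ'_lt_one := by norm_num
    contraction := fun g y y' _ _ _ => by
      rw [← smul_sub, norm_smul]; norm_num
    remainder_basin := fun g y _ _ => by simp only [sub_self, abs_zero]; positivity
    yW := fun g => ((1 : ℝ), g)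
    g₀ := 1
    g₀_pos := one_pos
    continuousOn_yW := by fun_prop
    norm_yW_le := fun g hg => by
      rw [Prod.norm_def, Real.norm_eq_abs, Real.norm_eq_abs, abs_one, abs_of_nonneg hg.1]
      exact max_le (by norm_num) (hg.2.trans (by norm_num))
    betaOf := fun g => κ / g ^ 2
    strictAntiOn_betaOf := by
      intro t ht t' ht' hlt
      simp only
      rw [div_lt_div_iff_of_pos_left hκ (by have := ht'.1; positivity) (by have := ht.1; positivity)]
      exact pow_lt_pow_left₀ hlt ht.1.le two_ne_zero
    continuousOn_betaOf := by
      refine continuousOn_of_forall_continuousAt fun t ht => ?_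
      have : t ^ 2 ≠ 0 := by have := ht.1; positivity
      fun_prop (disch := assumption)
    κ := κ
    κ_pos := hκ
    K := 0
    betaOf_sub_le := fun g _ => by simp
    c := c
    c_curvature := hc
    expect := X
    expect_step := fun g y hg hy S n σ f => h4a (g, y) S n σ f hg hy
    expect_wilson := h4b
    continuousOn_expect := h4c }⟩

end

end Summit.QuantumFields.YangMills.Theorems.BalabanStepParabolic.Negative
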